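import Summits.QuantumFields.BalabanUV.T4Continuum.Support.AveragingDeficitBlockDensity
import HarnessLib

/-!
# AveragingDeficitBlockDensityGrad (T⁴ programme, node NE3, row NE3-R2, gen 6) — THE COVARIANT GRADIENT OF THE BLOCK DENSITY:
# inside a block `‖D(S₀φ)‖ ≤ C·a·L⁻¹‖φ‖`, across a block face `D(S₀φ) = L⁻¹·(transported coarse covariant difference) + O(a)‖φ‖`
# (file 3 of (γ2), the gradient-bounded one-step lift — record `t4/T4-EST-NE3-R2.md` v0.6 §4; period sum in file 3b)

HONEST FRAMING (cell `pub-balaban`, T4-DAG PAGE 1; unit `b2b-balaban-t4-ne3r2-p1` = owner of BINDER-OWNERS row NE3-R2, gen 6).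
The cell's T4 target is the finite-torus continuum limit of the unit-scale averaged loop expectations — NOT infinite volume, NO
mass gap, NOT Clay, NOT summit progress.  WHY.  (γ2) needs the covariant gradient of the lift controlled by the coarse covariant
gradient of the datum; this file does it for the block density `S₀ = blockDensity` of file 2 (`AveragingDeficitBlockDensity`).
All [folklore], 0 sorry: §1 the two closed words of the gradient — the IN-BLOCK loop `Γ_{Ly,x+e_ν} ∪ −⟨x,x+e_ν⟩ ∪ ⟨x,x+e_μ⟩ ∪
⟨x+e_μ,x+e_μ+e_ν⟩ ∪ −Γ_{Ly,x+e_μ+e_ν}` (`loopWordA`) and the FACE loop through `−Γ_c` and the tree of the next block (`loopWordB`),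
their holonomy identities and the bounds `‖U(loop) − 1‖ ≤ |loop|²·a` from file 2's uniform loop lemma; §2 the pointwise structure:
`covFd U (S₀φ) x μ ν = L⁻¹·(Ad_{A} X′ − Ad_{B} X)` (`covFd_blockDensity_eq`); IN THE BLOCK (`⌊(x+e_μ)/L⌋ = ⌊x/L⌋`)
**`‖covFd U (S₀φ) x μ ν‖ ≤ L⁻¹·2(2dL+6)²a·‖φ(y,ν)‖`**; ACROSS THE FACE (`⌊(x+e_μ)/L⌋ = ⌊x/L⌋ + e_μ`)
**`‖covFd U (S₀φ) x μ ν − L⁻¹·Ad_T (covFd (cavg L U) φ y μ ν)‖ ≤ L⁻¹·[(2((2d+1)L+6)²a + 16·loopRad)‖φ(y+e_μ,ν)‖ + 8·loopRad·‖φ(y,ν)‖]`**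
(the `e^{X_c}` factors of `cavg` against the straight transports cost `4·loopRad` each, file 2 §5), and its squared form; the
PERIOD SUM is the sequel `AveragingDeficitBlockDensityGradSum`.  NE3 ITSELF IS NOT PROVED;
nothing of Bałaban's is asserted (context: [Balaban1985Averaging] (42) p. 23, p. 24–25).  ABSOLUTE RULE kept: no printed
sentence is a hypothesis.  PLACEMENT: `Summits/QuantumFields/BalabanUV/`; imports this row's `AveragingDeficitBlockDensity`; moves nothing.
-/

set_option autoImplicit false

open scoped BigOperators Matrix Matrix.Norms.L2Operator
open NormedSpace Finset

namespace Summit.QuantumFields.BalabanUV.T4Continuum.AveragingDeficitBlockDensityGrad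

open Literature.MathematicalPhysics.QuantumFieldTheory.Balaban1983to89
open B7Prop1Explicit B7Prop2Explicit MatrixLog UnitaryModel
open T4AveragingDeficitWall hiding Site Plane Plaq Bond
open T4AveragingDeficitWallBoundary (IsPeriodicCfg periodBox blockSites_periodBox sum_blocks_eq sum_periodBox_shift)
open T4AveragingDeficitNonAbelian (Ad_mul Ad_sub)
open AveragingDeficitPeriodicCounting (IsPeriodicDir)
open AveragingDeficitTransport (norm_Ad_of_unitary mem_U1_of_unitary)
open AveragingDeficitNearIdentity (Ad_one norm_Ad_sub_le Ad_real_smul)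
open AveragingDeficitChartCalculus (cavg)
open AveragingDeficitCovGrad (covFd covGradSq)
open SpreadLift (loopRad card_filter_coord_eq)
open SpreadLiftWords (cdiv_smul_add_boxVec cmod_smul_add_boxVec)
open SkeletonLattice (cdiv cmod)
open AveragingDeficitBlockDensity

noncomputable section

variable {d : ℕ} {n : Type*} [Fintype n] [DecidableEq n]

/-! ## §1 The two closed words of the gradient of the block density -/

omit [Fintype n] [DecidableEq n] in
/-- `|e_μ + e_ν|₁ ≤ 2`. [folklore] -/
theorem l1_e_add_e_le (μ ν : Fin d) : l1 (e μ + e ν : Site d) ≤ 2 := by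
  have h := l1_add_le (e μ : Site d) (e ν)
  rw [l1_e, l1_e] at h
  exact h

/-- THE IN-BLOCK LOOP at the corner `q`: `Γ_{q,x+e_ν} ∪ −⟨x,x+e_ν⟩ ∪ ⟨x,x+e_μ⟩ ∪ ⟨x+e_μ,x+e_μ+e_ν⟩ ∪ −Γ_{q,x+e_μ+e_ν}`. [folklore] -/
def loopWordA (q x : Site d) (μ ν : Fin d) : List (Letter d) :=
  treeWord (x + e ν - q) ++ ((ν, false) :: (μ, true) :: (ν, true) :: revWord (treeWord (x + e μ + e ν - q)))

omit [Fintype n] [DecidableEq n] in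
/-- The in-block loop is closed. [folklore] -/
theorem disp_loopWordA (q x : Site d) (μ ν : Fin d) : disp (loopWordA q x μ ν) = 0 := by
  simp only [loopWordA, disp_append, disp_treeWord, disp_cons, Letter.vec_false, Letter.vec_true, disp_revWord]
  abel

omit [Fintype n] [DecidableEq n] in
/-- Its length. [folklore] -/
theorem length_loopWordA (q x : Site d) (μ ν : Fin d) :
    (loopWordA q x μ ν).length = l1 (x + e ν - q) + l1 (x + e μ + e ν - q) + 3 := by
  simp only [loopWordA, List.length_append, length_treeWord, List.length_cons, length_revWord]
  ring

/-- **ITS HOLONOMY** is the transport discrepancy of the in-block gradient. [folklore] -/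
theorem hol_loopWordA (U : Site d → Fin d → (Matrix n n ℂ)ˣ) (q x : Site d) (μ ν : Fin d) :
    hol U q (loopWordA q x μ ν)
      = hol U q (treeWord (x + e ν - q)) * ((U x ν)⁻¹ * (U x μ * (U (x + e μ) ν
          * (hol U q (treeWord (x + e μ + e ν - q)))⁻¹))) := by
  rw [loopWordA, hol_append, disp_treeWord, show q + (x + e ν - q) = x + e ν by abel, hol_cons, stepHol_false,
    Letter.vec_false, show x + e ν - e ν = x by abel, show x + e ν + -e ν = x by abel, hol_cons, stepHol_true, Letter.vec_true,
    hol_cons, stepHol_true, Letter.vec_true,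
    hol_revWord' U (x := q) (x + e μ + e ν) (treeWord (x + e μ + e ν - q)) (by rw [disp_treeWord]; abel)]

/-- **IN-BLOCK LOOP BOUND**: at the corner `q = L⌊x/L⌋`, `‖U(loopA) − 1‖ ≤ (2dL+6)²·a`. [folklore] -/
theorem norm_hol_loopWordA_sub_one_le [Nonempty n] {L : ℕ} (hL : 1 ≤ L) {U : Site d → Fin d → (Matrix n n ℂ)ˣ}
    (hU : IsUnitaryCfg U) {a : ℝ} (ha : 0 ≤ a) (hUa : SmallField U a) (x : Site d) (μ ν : Fin d) :
    ‖((hol U ((L : ℤ) • cdiv L x) (loopWordA ((L : ℤ) • cdiv L x) x μ ν) : (Matrix n n ℂ)ˣ) : Matrix n n ℂ) - 1‖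
      ≤ (2 * d * L + 6 : ℝ) ^ 2 * a := by
  have h := norm_hol_closed_sub_one_le hU ha hUa ((L : ℤ) • cdiv L x) (loopWordA ((L : ℤ) • cdiv L x) x μ ν)
    (disp_loopWordA _ x μ ν)
  refine h.trans (mul_le_mul_of_nonneg_right ?_ ha)
  have hlen : (loopWordA ((L : ℤ) • cdiv L x) x μ ν).length ≤ 2 * d * L + 6 := by
    rw [length_loopWordA]
    have h1 := l1_add_sub_corner_le hL x (e ν)
    have h2 := l1_add_sub_corner_le hL x (e μ + e ν)
    rw [l1_e] at h1
    rw [← add_assoc] at h2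
    have h3 := l1_e_add_e_le (d := d) μ ν
    have h4 : 2 * d * L = 2 * (d * L) := by ring
    omega
  have : ((loopWordA ((L : ℤ) • cdiv L x) x μ ν).length : ℝ) ≤ 2 * d * L + 6 := by exact_mod_cast hlen
  exact pow_le_pow_left₀ (Nat.cast_nonneg _) this 2

/-- THE FACE LOOP at the corner `q′ = q + Le_μ` of the next block: `−Γ_c ∪ Γ_{q,x+e_ν} ∪ −⟨x,x+e_ν⟩ ∪ ⟨x,x+e_μ⟩ ∪
⟨x+e_μ,x+e_μ+e_ν⟩ ∪ −Γ_{q′,x+e_μ+e_ν}`. [folklore] -/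
def loopWordB (L : ℕ) (q x : Site d) (μ ν : Fin d) : List (Letter d) :=
  seg μ (-(L : ℤ)) ++ (treeWord (x + e ν - q)
    ++ ((ν, false) :: (μ, true) :: (ν, true) :: revWord (treeWord (x + e μ + e ν - (q + (L : ℤ) • e μ)))))

omit [Fintype n] [DecidableEq n] in
/-- The face loop is closed. [folklore] -/
theorem disp_loopWordB (L : ℕ) (q x : Site d) (μ ν : Fin d) : disp (loopWordB L q x μ ν) = 0 := by
  simp only [loopWordB, disp_append, disp_seg, disp_treeWord, disp_cons, Letter.vec_false, Letter.vec_true, disp_revWord,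
    neg_smul]
  abel

omit [Fintype n] [DecidableEq n] in
/-- Its length. [folklore] -/
theorem length_loopWordB (L : ℕ) (q x : Site d) (μ ν : Fin d) :
    (loopWordB L q x μ ν).length = L + l1 (x + e ν - q) + l1 (x + e μ + e ν - (q + (L : ℤ) • e μ)) + 3 := by
  simp only [loopWordB, List.length_append, length_seg, length_treeWord, List.length_cons, length_revWord,
    Int.natAbs_neg, Int.natAbs_natCast]
  ring

/-- **ITS HOLONOMY** (read from `q′ = q + Le_μ`) is the transport discrepancy of the face gradient. [folklore] -/
theorem hol_loopWordB (L : ℕ) (U : Site d → Fin d → (Matrix n n ℂ)ˣ) (q x : Site d) (μ ν : Fin d) :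
    hol U (q + (L : ℤ) • e μ) (loopWordB L q x μ ν)
      = (hol U q (seg μ L))⁻¹ * (hol U q (treeWord (x + e ν - q)) * ((U x ν)⁻¹ * (U x μ * (U (x + e μ) ν
          * (hol U (q + (L : ℤ) • e μ) (treeWord (x + e μ + e ν - (q + (L : ℤ) • e μ))))⁻¹)))) := by
  rw [loopWordB, hol_append, disp_seg, show q + (L : ℤ) • e μ + -(L : ℤ) • e μ = q by rw [neg_smul]; abel,
    show seg μ (-(L : ℤ)) = revWord (seg μ (L : ℤ)) by rw [revWord_seg],
    hol_revWord' U (x := q) (q + (L : ℤ) • e μ) (seg μ (L : ℤ)) (by rw [disp_seg]),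
    hol_append, disp_treeWord, show q + (x + e ν - q) = x + e ν by abel, hol_cons, stepHol_false,
    Letter.vec_false, show x + e ν - e ν = x by abel, show x + e ν + -e ν = x by abel, hol_cons, stepHol_true, Letter.vec_true,
    hol_cons, stepHol_true, Letter.vec_true,
    hol_revWord' U (x := q + (L : ℤ) • e μ) (x + e μ + e ν) (treeWord (x + e μ + e ν - (q + (L : ℤ) • e μ)))
      (by rw [disp_treeWord]; abel)]

/-- **FACE LOOP BOUND**: for `x` on the exit face of its block in direction `μ` (`⌊(x+e_μ)/L⌋ = ⌊x/L⌋ + e_μ`), at `q = L⌊x/L⌋`,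
`‖U(loopB) − 1‖ ≤ ((2d+1)L+6)²·a`. [folklore] -/
theorem norm_hol_loopWordB_sub_one_le [Nonempty n] {L : ℕ} (hL : 1 ≤ L) {U : Site d → Fin d → (Matrix n n ℂ)ˣ}
    (hU : IsUnitaryCfg U) {a : ℝ} (ha : 0 ≤ a) (hUa : SmallField U a) (x : Site d) (μ ν : Fin d)
    (hcross : cdiv L (x + e μ) = cdiv L x + e μ) :
    ‖((hol U ((L : ℤ) • cdiv L x + (L : ℤ) • e μ) (loopWordB L ((L : ℤ) • cdiv L x) x μ ν) : (Matrix n n ℂ)ˣ)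
        : Matrix n n ℂ) - 1‖ ≤ ((2 * d + 1) * L + 6 : ℝ) ^ 2 * a := by
  have h := norm_hol_closed_sub_one_le hU ha hUa ((L : ℤ) • cdiv L x + (L : ℤ) • e μ)
    (loopWordB L ((L : ℤ) • cdiv L x) x μ ν) (disp_loopWordB L _ x μ ν)
  refine h.trans (mul_le_mul_of_nonneg_right ?_ ha)
  have hlen : (loopWordB L ((L : ℤ) • cdiv L x) x μ ν).length ≤ (2 * d + 1) * L + 6 := by
    rw [length_loopWordB]
    have h1 := l1_add_sub_corner_le hL x (e ν)
    rw [l1_e] at h1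
    have h2 := l1_add_sub_corner_le hL (x + e μ) (e ν)
    rw [l1_e, hcross, smul_add] at h2
    have h3 : (2 * d + 1) * L = 2 * (d * L) + L := by ring
    omega
  have : ((loopWordB L ((L : ℤ) • cdiv L x) x μ ν).length : ℝ) ≤ (2 * d + 1) * L + 6 := by exact_mod_cast hlen
  exact pow_le_pow_left₀ (Nat.cast_nonneg _) this 2

/-! ## §2 The covariant gradient of the block density, pointwise -/

/-- **STRUCTURE**: `covFd U (S₀φ) x μ ν = L⁻¹·(Ad_{U(x,μ)U(x+e_μ,ν)U(Γ_{q′·,x+e_μ+e_ν})⁻¹} X′ − Ad_{U(x,ν)U(Γ_{q,x+e_ν})⁻¹} X)` with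
`X = Ad_{U(Γ_c)}φ(⌊x/L⌋,ν)`, `X′ = Ad_{U(Γ_{c′})}φ(⌊(x+e_μ)/L⌋,ν)`. [folklore] -/
theorem covFd_blockDensity_eq (L : ℕ) (U : Site d → Fin d → (Matrix n n ℂ)ˣ) (φ : Site d → Fin d → Matrix n n ℂ)
    (x : Site d) (μ ν : Fin d) :
    covFd U (blockDensity L U φ) x μ ν
      = ((L : ℝ)⁻¹) • (Ad (U x μ * U (x + e μ) ν * (btree L U (cdiv L (x + e μ)) (x + e μ + e ν))⁻¹)
            (Ad (bseg L U (cdiv L (x + e μ)) ν) (φ (cdiv L (x + e μ)) ν))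
          - Ad (U x ν * (btree L U (cdiv L x) (x + e ν))⁻¹) (Ad (bseg L U (cdiv L x) ν) (φ (cdiv L x) ν))) := by
  simp only [covFd, blockDensity_apply, Ad_real_smul, Ad_mul, smul_sub]

section Pointwise

variable [Nonempty n] {L : ℕ} (hL : 1 ≤ L) {U : Site d → Fin d → (Matrix n n ℂ)ˣ} (hU : IsUnitaryCfg U) {a : ℝ} (ha : 0 ≤ a)
  (h512 : 512 * (d + 1) * (d + 4) * (L : ℝ) ^ 2 * a ≤ 1) (hUa : SmallField U a)

include hL hU ha hUa

/-- **IN THE BLOCK**: `‖covFd U (S₀φ) x μ ν‖ ≤ L⁻¹·2(2dL+6)²a·‖φ(⌊x/L⌋, ν)‖` when `⌊(x+e_μ)/L⌋ = ⌊x/L⌋`. [folklore] -/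
theorem norm_covFd_blockDensity_same_le (φ : Site d → Fin d → Matrix n n ℂ) (x : Site d) (μ ν : Fin d)
    (hsame : cdiv L (x + e μ) = cdiv L x) :
    ‖covFd U (blockDensity L U φ) x μ ν‖ ≤ (L : ℝ)⁻¹ * (2 * ((2 * d * L + 6 : ℝ) ^ 2 * a)) * ‖φ (cdiv L x) ν‖ := by
  have hL0 : (0 : ℝ) ≤ (L : ℝ)⁻¹ := by positivity
  rw [covFd_blockDensity_eq, hsame, norm_smul, norm_inv, Real.norm_natCast]
  have hA : U x μ * U (x + e μ) ν * (btree L U (cdiv L x) (x + e μ + e ν))⁻¹ ∈ unitaryUnits (Matrix n n ℂ) :=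
    (unitaryUnits _).mul_mem ((unitaryUnits _).mul_mem (hU x μ) (hU _ ν)) ((unitaryUnits _).inv_mem (btree_mem hU L _ _))
  have hB : U x ν * (btree L U (cdiv L x) (x + e ν))⁻¹ ∈ unitaryUnits (Matrix n n ℂ) :=
    (unitaryUnits _).mul_mem (hU x ν) ((unitaryUnits _).inv_mem (btree_mem hU L _ _))
  have hloop := norm_hol_loopWordA_sub_one_le hL hU ha hUa x μ ν
  rw [hol_loopWordA] at hloop
  have hkey : (U x ν * (btree L U (cdiv L x) (x + e ν))⁻¹)⁻¹ * (U x μ * U (x + e μ) ν * (btree L U (cdiv L x) (x + e μ + e ν))⁻¹)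
      = hol U ((L : ℤ) • cdiv L x) (treeWord (x + e ν - (L : ℤ) • cdiv L x))
        * ((U x ν)⁻¹ * (U x μ * (U (x + e μ) ν * (hol U ((L : ℤ) • cdiv L x) (treeWord (x + e μ + e ν - (L : ℤ) • cdiv L x)))⁻¹))) := by
    simp only [btree, mul_inv_rev, inv_inv, mul_assoc]
  have h := norm_Ad_sub_Ad_le_of_le hA hB (Ad (bseg L U (cdiv L x) ν) (φ (cdiv L x) ν))
    (t := (2 * d * L + 6 : ℝ) ^ 2 * a) (by rw [hkey]; exact hloop)
  rw [norm_Ad_of_unitary (bseg_mem hU L _ ν)] at h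
  calc (L : ℝ)⁻¹ * _ ≤ (L : ℝ)⁻¹ * (2 * ((2 * d * L + 6 : ℝ) ^ 2 * a) * ‖φ (cdiv L x) ν‖) := mul_le_mul_of_nonneg_left h hL0
    _ = _ := by ring

include h512

/-- **ACROSS THE FACE**: when `⌊(x+e_μ)/L⌋ = ⌊x/L⌋ + e_μ` (`y = ⌊x/L⌋`, `T = U(x,ν)U(Γ_{Ly,x+e_ν})⁻¹` the transport from the corner),
`‖covFd U (S₀φ) x μ ν − L⁻¹·Ad_T (covFd (cavg L U) φ y μ ν)‖ ≤ L⁻¹·[(2((2d+1)L+6)²a + 16·loopRad)·‖φ(y+e_μ,ν)‖ + 8·loopRad·‖φ(y,ν)‖]`.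
[folklore] -/
theorem norm_covFd_blockDensity_cross_sub_le (φ : Site d → Fin d → Matrix n n ℂ) (x : Site d) (μ ν : Fin d)
    (hcross : cdiv L (x + e μ) = cdiv L x + e μ) :
    ‖covFd U (blockDensity L U φ) x μ ν
        - ((L : ℝ)⁻¹) • Ad (U x ν * (btree L U (cdiv L x) (x + e ν))⁻¹) (covFd (cavg L U) φ (cdiv L x) μ ν)‖
      ≤ (L : ℝ)⁻¹ * ((2 * (((2 * d + 1) * L + 6 : ℝ) ^ 2 * a) + 16 * loopRad d L a) * ‖φ (cdiv L x + e μ) ν‖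
          + 8 * loopRad d L a * ‖φ (cdiv L x) ν‖) := by
  -- names
  set y : Site d := cdiv L x with hy
  set T : (Matrix n n ℂ)ˣ := U x ν * (btree L U y (x + e ν))⁻¹ with hT
  set A : (Matrix n n ℂ)ˣ := U x μ * U (x + e μ) ν * (btree L U (y + e μ) (x + e μ + e ν))⁻¹ with hA
  set X' : Matrix n n ℂ := Ad (bseg L U (y + e μ) ν) (φ (y + e μ) ν) with hX'
  set X : Matrix n n ℂ := Ad (bseg L U y ν) (φ y ν) with hX
  -- unitarity
  have hUc : ∀ z κ, cavg L U z κ ∈ unitaryUnits (Matrix n n ℂ) := fun z κ => cavg_mem hL hU ha h512 hUa z κ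
  have hTu : T ∈ unitaryUnits (Matrix n n ℂ) :=
    (unitaryUnits _).mul_mem (hU x ν) ((unitaryUnits _).inv_mem (btree_mem hU L _ _))
  have hAu : A ∈ unitaryUnits (Matrix n n ℂ) :=
    (unitaryUnits _).mul_mem ((unitaryUnits _).mul_mem (hU x μ) (hU _ ν)) ((unitaryUnits _).inv_mem (btree_mem hU L _ _))
  have hX'n : ‖X'‖ = ‖φ (y + e μ) ν‖ := norm_Ad_of_unitary (bseg_mem hU L _ ν) _
  have hXn : ‖X‖ = ‖φ y ν‖ := norm_Ad_of_unitary (bseg_mem hU L _ ν) _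
  have hlr0 : 0 ≤ loopRad d L a := by unfold SpreadLift.loopRad; positivity
  -- the structure of the two terms
  have e1 : covFd U (blockDensity L U φ) x μ ν = ((L : ℝ)⁻¹) • (Ad A X' - Ad T X) := by
    rw [covFd_blockDensity_eq, hcross]
  have e2 : ((L : ℝ)⁻¹) • Ad T (covFd (cavg L U) φ y μ ν)
      = ((L : ℝ)⁻¹) • (Ad (T * cavg L U y μ * cavg L U (y + e μ) ν) (φ (y + e μ) ν) - Ad (T * cavg L U y ν) (φ y ν)) := by
    simp only [covFd, Ad_sub, Ad_mul]
  -- step 1: replace `cavg (y+e_μ) ν` by `bseg (y+e_μ) ν`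
  have s1 : ‖Ad (T * cavg L U y μ * cavg L U (y + e μ) ν) (φ (y + e μ) ν) - Ad (T * cavg L U y μ) X'‖
      ≤ 2 * (4 * loopRad d L a) * ‖φ (y + e μ) ν‖ := by
    rw [Ad_mul (T * cavg L U y μ) (cavg L U (y + e μ) ν), hX', ← Ad_sub,
      norm_Ad_of_unitary ((unitaryUnits _).mul_mem hTu (hUc y μ))]
    exact norm_Ad_sub_Ad_le_of_le (hUc _ ν) (bseg_mem hU L _ ν) _ (norm_bseg_inv_cavg_sub_one_le hL hU ha h512 hUa _ ν)
  -- step 2: replace `cavg y μ` by `bseg y μ`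
  have s2 : ‖Ad (T * cavg L U y μ) X' - Ad (T * bseg L U y μ) X'‖ ≤ 2 * (4 * loopRad d L a) * ‖φ (y + e μ) ν‖ := by
    rw [← hX'n]
    refine norm_Ad_sub_Ad_le_of_le ((unitaryUnits _).mul_mem hTu (hUc y μ)) ((unitaryUnits _).mul_mem hTu (bseg_mem hU L y μ)) X' ?_
    rw [show (T * bseg L U y μ)⁻¹ * (T * cavg L U y μ) = (bseg L U y μ)⁻¹ * cavg L U y μ by
      rw [mul_inv_rev, mul_assoc, inv_mul_cancel_left]]
    exact norm_bseg_inv_cavg_sub_one_le hL hU ha h512 hUa y μ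
  -- step 3: the face loop
  have s3 : ‖Ad A X' - Ad (T * bseg L U y μ) X'‖ ≤ 2 * (((2 * d + 1) * L + 6 : ℝ) ^ 2 * a) * ‖φ (y + e μ) ν‖ := by
    rw [← hX'n]
    refine norm_Ad_sub_Ad_le_of_le hAu ((unitaryUnits _).mul_mem hTu (bseg_mem hU L y μ)) X' ?_
    have hloop := norm_hol_loopWordB_sub_one_le hL hU ha hUa x μ ν hcross
    rw [hol_loopWordB] at hloop
    have hkey : (T * bseg L U y μ)⁻¹ * A
        = (hol U ((L : ℤ) • cdiv L x) (seg μ L))⁻¹ * (hol U ((L : ℤ) • cdiv L x) (treeWord (x + e ν - (L : ℤ) • cdiv L x))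
          * ((U x ν)⁻¹ * (U x μ * (U (x + e μ) ν * (hol U ((L : ℤ) • cdiv L x + (L : ℤ) • e μ)
              (treeWord (x + e μ + e ν - ((L : ℤ) • cdiv L x + (L : ℤ) • e μ))))⁻¹)))) := by
      simp only [hT, hA, hy, btree, bseg, smul_add, mul_inv_rev, inv_inv, mul_assoc]
    rw [hkey]; exact hloop
  -- the own-block term: replace `cavg y ν` by `bseg y ν`
  have s4 : ‖Ad T X - Ad (T * cavg L U y ν) (φ y ν)‖ ≤ 2 * (4 * loopRad d L a) * ‖φ y ν‖ := by
    rw [hX, Ad_mul T (cavg L U y ν), ← Ad_sub, norm_Ad_of_unitary hTu]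
    exact norm_Ad_sub_Ad_le_of_le (bseg_mem hU L _ ν) (hUc _ ν) _ (norm_cavg_inv_bseg_sub_one_le hL hU ha h512 hUa _ ν)
  -- assemble
  have hL0 : (0 : ℝ) ≤ (L : ℝ)⁻¹ := by positivity
  rw [e1, e2, ← smul_sub, norm_smul, norm_inv, Real.norm_natCast]
  refine mul_le_mul_of_nonneg_left ?_ hL0
  have split : Ad A X' - Ad T X - (Ad (T * cavg L U y μ * cavg L U (y + e μ) ν) (φ (y + e μ) ν) - Ad (T * cavg L U y ν) (φ y ν))
      = (Ad A X' - Ad (T * bseg L U y μ) X') + (Ad (T * bseg L U y μ) X' - Ad (T * cavg L U y μ) X')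
        - (Ad (T * cavg L U y μ * cavg L U (y + e μ) ν) (φ (y + e μ) ν) - Ad (T * cavg L U y μ) X')
        + (Ad (T * cavg L U y ν) (φ y ν) - Ad T X) := by abel
  rw [split]
  have t1 := norm_add_le (Ad A X' - Ad (T * bseg L U y μ) X') (Ad (T * bseg L U y μ) X' - Ad (T * cavg L U y μ) X')
  have t2 := norm_sub_le ((Ad A X' - Ad (T * bseg L U y μ) X') + (Ad (T * bseg L U y μ) X' - Ad (T * cavg L U y μ) X'))
    (Ad (T * cavg L U y μ * cavg L U (y + e μ) ν) (φ (y + e μ) ν) - Ad (T * cavg L U y μ) X')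
  have t3 := norm_add_le ((Ad A X' - Ad (T * bseg L U y μ) X') + (Ad (T * bseg L U y μ) X' - Ad (T * cavg L U y μ) X')
    - (Ad (T * cavg L U y μ * cavg L U (y + e μ) ν) (φ (y + e μ) ν) - Ad (T * cavg L U y μ) X'))
    (Ad (T * cavg L U y ν) (φ y ν) - Ad T X)
  rw [norm_sub_rev] at s2
  rw [norm_sub_rev] at s4
  nlinarith [s1, s2, s3, s4, t1, t2, t3, norm_nonneg (φ (y + e μ) ν), norm_nonneg (φ y ν)]

/-- **SQUARED, ACROSS THE FACE**: `‖covFd U (S₀φ) x μ ν‖² ≤ 2L⁻²‖covFd (cavg L U) φ y μ ν‖² + 4L⁻²(c₁²‖φ(y+e_μ,ν)‖² + c₂²‖φ(y,ν)‖²)`.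
[folklore] -/
theorem normSq_covFd_blockDensity_cross_le (φ : Site d → Fin d → Matrix n n ℂ) (x : Site d) (μ ν : Fin d)
    (hcross : cdiv L (x + e μ) = cdiv L x + e μ) :
    ‖covFd U (blockDensity L U φ) x μ ν‖ ^ 2
      ≤ 2 * ((L : ℝ)⁻¹) ^ 2 * ‖covFd (cavg L U) φ (cdiv L x) μ ν‖ ^ 2
        + 4 * ((L : ℝ)⁻¹) ^ 2 * (((2 * (((2 * d + 1) * L + 6 : ℝ) ^ 2 * a) + 16 * loopRad d L a)) ^ 2 * ‖φ (cdiv L x + e μ) ν‖ ^ 2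
            + (8 * loopRad d L a) ^ 2 * ‖φ (cdiv L x) ν‖ ^ 2) := by
  have h := norm_covFd_blockDensity_cross_sub_le hL hU ha h512 hUa φ x μ ν hcross
  set F := covFd U (blockDensity L U φ) x μ ν with hF
  set Tm := ((L : ℝ)⁻¹) • Ad (U x ν * (btree L U (cdiv L x) (x + e ν))⁻¹) (covFd (cavg L U) φ (cdiv L x) μ ν) with hTm
  have hTn : ‖Tm‖ = (L : ℝ)⁻¹ * ‖covFd (cavg L U) φ (cdiv L x) μ ν‖ := by
    rw [hTm, norm_smul, norm_inv, Real.norm_natCast,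
      norm_Ad_of_unitary ((unitaryUnits _).mul_mem (hU x ν) ((unitaryUnits _).inv_mem (btree_mem hU L _ _)))]
  have htri : ‖F‖ ≤ ‖Tm‖ + ‖F - Tm‖ := by
    have := norm_add_le Tm (F - Tm); rwa [add_sub_cancel] at this
  set c₁ := (2 * (((2 * d + 1) * L + 6 : ℝ) ^ 2 * a) + 16 * loopRad d L a) with hc₁
  set c₂ := 8 * loopRad d L a with hc₂
  set P := ‖φ (cdiv L x + e μ) ν‖
  set Q := ‖φ (cdiv L x) ν‖
  set G := ‖covFd (cavg L U) φ (cdiv L x) μ ν‖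
  have hL0 : 0 ≤ (L : ℝ)⁻¹ := by positivity
  have hlr0 : 0 ≤ loopRad d L a := by unfold SpreadLift.loopRad; positivity
  have hc₁0 : 0 ≤ c₁ := by positivity
  have hc₂0 : 0 ≤ c₂ := by positivity
  have hP : 0 ≤ P := norm_nonneg _
  have hQ : 0 ≤ Q := norm_nonneg _
  have hG : 0 ≤ G := norm_nonneg _
  have hFle : ‖F‖ ≤ (L : ℝ)⁻¹ * G + (L : ℝ)⁻¹ * (c₁ * P + c₂ * Q) := by rw [← hTn]; linarith
  have hF0 : 0 ≤ ‖F‖ := norm_nonneg _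
  calc ‖F‖ ^ 2 ≤ ((L : ℝ)⁻¹ * G + (L : ℝ)⁻¹ * (c₁ * P + c₂ * Q)) ^ 2 := pow_le_pow_left₀ hF0 hFle 2
    _ ≤ 2 * ((L : ℝ)⁻¹) ^ 2 * G ^ 2 + 4 * ((L : ℝ)⁻¹) ^ 2 * (c₁ ^ 2 * P ^ 2 + c₂ ^ 2 * Q ^ 2) := by
        nlinarith [sq_nonneg ((L : ℝ)⁻¹ * G - (L : ℝ)⁻¹ * (c₁ * P + c₂ * Q)), sq_nonneg (c₁ * P - c₂ * Q),
          mul_nonneg hL0 hG, mul_nonneg hc₁0 hP, mul_nonneg hc₂0 hQ]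

end Pointwise

end

end Summit.QuantumFields.BalabanUV.T4Continuum.AveragingDeficitBlockDensityGrad
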